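import Mathlib
import Summits.Ventures.HodgeRepro2.T6Interface
import Summits.Ventures.HodgeRepro2.T6A1WeilLine

/-!
# T6A1Main — sub-goal A1 over the Tier-6 interface: LINE-HIT for `weilQ` (Theorem A1(iv))

Tier-6 sub-goal A1 (route/T6-A1-t6-p1.md §1; TARGET-T6.md §2 Layer II, §4 row L2). The interface
(`T6Interface`, t6-lead) models `H^*(B, ℚ)` as the explicit exterior algebra `HB K = ⋀ (Fin 4 → K)`,
the pull-back `[x]^*` as `pullEndo K x`, the rational split Weil line as `weilQ K` (p1's `weilLine`) and
the algebraic classes as the field `Alg` of a `TransferShadow` with `alg_pull` (Fulton Cor. 19.2(b):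
`[x]^*` preserves algebraic classes) and `alg_deg`. This file is the glue: `pullEndo K x` on
`H⁴(B, ℚ) = ⋀[ℚ]^4 (Fin 4 → K)` IS the operator `T` of `T6A1WeilProjector` (`pullEndo_coe_T`), and
therefore Theorem A1(iv) — LINE-HIT, `T6A1WeilLine.weilLine_le_of_inf_ne_bot` — reads: if one non-zero
split Weil class is algebraic then every split Weil class is (`A1_lineHit`, the statement t6-p3's
`theoremA_of_N` consumes). The CM field `K` is Galois over `ℚ` (the brief's F; `[IsGalois ℚ K]`).
-/

namespace Summit.Ventures.HodgeRepro2.T6.A1Main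

open A1WeilProjector A1WeilLine

variable (K : Type*) [Field K] [NumberField K]

/-- `actH1 K x` is the diagonal scalar action `x • v` on `H¹(B, ℚ) = Fin 4 → K`. -/
theorem actH1_apply (x : K) (v : H1 K) : actH1 K x v = x • v := by
  funext i
  simp [actH1]

/-- `pullEndo K x` restricted to `H⁴(B, ℚ) = ⋀[ℚ]^4 (Fin 4 → K)` is the correspondence
`T K (H1 K) 4 x = ⋀⁴(x •)` of `T6A1WeilProjector` (TIER4 (A0.3)(ii),(iv)). -/
theorem pullEndo_coe_T (x : K) (v : ⋀[ℚ]^4 (H1 K)) :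
    pullEndo K x (v : HB K) = (T K (H1 K) 4 x v : HB K) := by
  have h : (pullEndo K x).toLinearMap ∘ₗ (⋀[ℚ]^4 (H1 K)).subtype =
      (⋀[ℚ]^4 (H1 K)).subtype ∘ₗ T K (H1 K) 4 x := by
    apply exteriorPower.linearMap_ext
    ext w
    simp only [LinearMap.compAlternatingMap_apply, LinearMap.comp_apply, Submodule.subtype_apply,
      AlgHom.toLinearMap_apply, T_apply_ιMulti, exteriorPower.ιMulti_apply_coe,
      ExteriorAlgebra.ιMulti_apply, map_list_prod, List.map_ofFn]
    congr 2
    funext i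
    simp only [Function.comp_apply, pullEndo, ExteriorAlgebra.lift_ι_apply, LinearMap.comp_apply,
      actH1_apply]
  exact LinearMap.congr_fun h v

variable {K}

/-- THEOREM A1(iv), LINE-HIT, over the interface (TIER4 Lemma A3.1 + Prop. A3.2): if one non-zero element
of the rational split Weil line `weilQ K` is an algebraic class, every element of `weilQ K` is — i.e.
`WeilClassesAlgebraic D`, the conclusion of Theorem A. Inputs consumed: `D.alg_pull` (Fulton Cor. 19.2(b))
and `D.alg_deg`; the CM field is Galois over `ℚ`. -/
theorem A1_lineHit [IsGalois ℚ K] {F : FaceSetting K} (D : TransferShadow F)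
    (hw : ∃ w ∈ weilQ K, w ≠ 0 ∧ w ∈ D.Alg 2) : WeilClassesAlgebraic D := by
  classical
  -- the algebraic classes of degree 4, read inside ⋀[ℚ]^4 (Fin 4 → K)
  let A : Submodule ℚ (⋀[ℚ]^4 (H1 K)) := (D.Alg 2).comap (⋀[ℚ]^4 (H1 K)).subtype
  have hA : ∀ x : K, ∀ v ∈ A, T K (H1 K) 4 x v ∈ A := by
    intro x v hv
    show (T K (H1 K) 4 x v : HB K) ∈ D.Alg 2
    rw [← pullEndo_coe_T]
    exact D.alg_pull x hv
  have hne : A ⊓ weilLine (K := K) 4 (H1 K) ≠ ⊥ := by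
    obtain ⟨w, hw, hw0, hwA⟩ := hw
    obtain ⟨w', hw', rfl⟩ := Submodule.mem_map.1 hw
    rw [Submodule.ne_bot_iff]
    refine ⟨w', ⟨hwA, hw'⟩, ?_⟩
    rintro rfl
    exact hw0 (by simp)
  have hle := weilLine_le_of_inf_ne_bot K (H1 K) (Module.finrank_fin_fun K) A hA hne
  intro w hw
  obtain ⟨w', hw', rfl⟩ := Submodule.mem_map.1 hw
  exact hle hw'

end Summit.Ventures.HodgeRepro2.T6.A1Main
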